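import Mathlib
import Literature.Analysis.FluidPDE.AcceleratingDissipationEnhancement
import Literature.Analysis.FunctionSpaces.TorusSobolevNorm
import HarnessLib

/-!
# Hess-Childs–Rowan (2025): a universal total anomalous dissipator (Theorem 1.1, Corollary 1.3)

Named facts (Literature is sorry-free; users take `(h : HessChildsRowan2025a_thm11)` etc.).

Source: E. Hess-Childs, K. Rowan, *A universal total anomalous dissipator*, arXiv:2501.18526v1
(30 Jan 2025), 30 pp. [cite: HessChildsRowan2025a]. Statements (PDF pages; TeX checked):

* **Theorem 1.1** (p. 1): "For all `α ∈ (0,1)`, there exists a constant `C(α) > 0` and a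
  divergence-free vector field `V ∈ L^∞([0,1], C^α(T²)) ∩ C^{α/(1-α)}([0,1], L^∞(T²))` so that for
  all mean-zero `θ₀ ∈ TV(T²)` and `κ > 0`, the unique solution `θ^κ` to (1.1)
  [`∂ₜθ^κ - κΔθ^κ + V·∇θ^κ = 0` in `(0,1) × T²`, `θ^κ(0,·) = θ₀`] satisfies the estimate
  `‖θ^κ(1,·)‖_{L¹(T²)} ≤ C κ^{(1-α)²/72} ‖θ₀‖_{TV(T²)}`. (1.2)"; "for `a ∈ [0,∞)`, we use `C^a` to
  denote the Hölder space `C^{⌊a⌋, a-⌊a⌋}`."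
* **Definition 1.2** (p. 2): "Let `V : [0,1] × T² → ℝ²` be as in Theorem 1.1. Then we define
  `W : [0,1] × T² → ℝ²`, `W(t,x) := V(4t-1, x) 1_{t ∈ [1/4,1/2]} + V(3-4t, x) 1_{t ∈ [1/2,3/4]}`."
* **Corollary 1.3** (p. 2): "For all `α ∈ (0,1)`, there exists a constant `C(α) > 0` so that for
  all mean-zero `θ₀` and `κ > 0`, the unique solution `θ^κ` to (1.1) — with `W` of Definition 1.2
  in place of `V` — satisfies the estimates
  `‖θ^κ(1,·)‖_{L^p(T²)} ≤ C κ^{(1-α)²/72} ‖θ₀‖_{L^p(T²)}` for all `p ∈ [1,∞]` (1.3), and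
  `‖θ^κ(1,·)‖_{H^σ(T²)} ≤ C κ^{(1-α)²/144} ‖θ₀‖_{H^{-σ}(T²)}` for all `σ ∈ [0, (1-α)²/288]` (1.4)."
* The field (Def. 2.11, (2.4), p. 11): `V(t,x) := 0` for `t ≤ 1/2` and
  `σₙ⁻¹ Rⁿ v(σₙ⁻¹(t - s_{n+1}), R⁻ⁿ x)` for `t ∈ [s_{n+1}, sₙ]`
  (`σⱼ = ½(2^{(α-1)j/2} - 2^{(α-1)(j+1)/2})`, `sₙ = ½ + ∑_{j ≥ n} σⱼ`, `R = 2^{-1/2}·rot(π/2)`, `v` the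
  two-cell dissipating flow (2.2) built on the Alberti–Crippa–Mazzucato mixer, Thm. 2.6);
  **Lemma 2.12** (p. 12): "`V ∈ L^∞([0,1], C^α(T²)) ∩ C^{α/(1-α)}([0,1], L^∞(T²))`."
* **The torus of the source** (Def. 2.2, p. 7): "We let `B := [0, √2] × [0, 1]` and take `T²` to be
  `B` with opposite sides identified" — the flat torus `ℝ²/(√2ℤ ⊕ ℤ)` with the isotropic `κΔ`, as
  in the companion paper arXiv:2508.00115 [cite: HessChildsRowan2025b] typed in
  `AcceleratingDissipationEnhancement.lean` (`HessChildsRowan2025_cor12`).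

## Rendering (the same as `HessChildsRowan2025_cor12`; see that module docstring, *Rendering*)

The tree has the unit torus `T² = UnitAddTorus (Fin 2)` only. Pulling back along
`Φ (x₀, x₁) = (√2 x₀, x₁)`, the isotropic equation on `ℝ²/(√2ℤ ⊕ ℤ)` is *exactly* the unit-torus
equation `∂ₜθ + V'·∇θ = κ (½ ∂₀∂₀ + ∂₁∂₁) θ`, i.e. the weak class
`Torus.IsWeakScalarTransportDiagOn T ![2⁻¹, 1] κ V θ₀ θ` of `AcceleratingDissipationEnhancement.lean`
(DiPerna–Lions weak solutions, `θ ∈ L^∞_t L²_x`). The pull-back preserves: means, boundedness,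
divergence-freeness (also weakly), spatial `α`-Hölder continuity (constant `× (√2)^α`), every
regularity in time, and every ratio `‖θ(1)‖_{L^p}/‖θ₀‖_{L^p}` (both sides scale by the same power
of the area `√2`); the spectral `H^{±σ}` norms of the flat torus `ℝ²/(√2ℤ ⊕ ℤ)` (weights
`(1 + k₀²/2 + k₁²)^{±σ/2}` on the same index lattice `k ∈ ℤ²`) and the tree's unit-torus norms
`Torus.eSobolevNorm (±σ)` (weights `(1 + k₀² + k₁²)^{±σ/2}`) differ by factors in `[2^{-σ/2}, 1]`,
uniformly bounded for `σ` in the printed bounded range — absorbed in the (unspecified) constant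
`C(α)`. So the facts below are the printed statements up to the value of `C(α)`.

"The unique solution `θ^κ`" (for `κ > 0`, a bounded divergence-free drift and an `L²` datum the
weak solutions in `L^∞_t L²_x` are unique energy solutions, lying in `C([0,1]; L²)`) is rendered,
as in `ArmstrongVicol2025.IsTimeHolderAlong` (`TurbPassiveScalar.lean`), as *every* weak solution on
`T² × [0,1)` whose time slices form the `L²`-continuous representative on `[0,1]`
(`Torus.IsL2ContinuousOn (Icc 0 1) θ`): the tree's weak solutions are determined for a.e. `t` only,
and the estimates concern the time-`1` slice `θ(1)`.

The field is packaged existentially with the printed structural properties (`HessChildsRowan2025a.IsCarrier`):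
space–time measurable; bounded; `α`-Hölder in space with one constant at every time
(`L^∞_t C^α_x`); Hölder in time into `L^∞_x` on `[0,1]` with exponent `min(1, α/(1-α))` (see
*Recorded weakenings*); weakly divergence free at every time; `V(t,·) = 0` for `t ≤ 1/2` ((2.4)).
A representative defined for every `t ∈ ℝ` changes nothing for weak solutions on `[0,1)`.

## Recorded weakenings / readings (never a strengthening)

1. DATA CLASS. Thm. 1.1 is printed for mean-zero measures `θ₀ ∈ TV(T²)` (`‖θ^κ(1)‖_{L¹} ≤ … ‖θ₀‖_{TV}`),
   (1.3) for `θ₀ ∈ L^p`, (1.4) for `θ₀ ∈ H^{-σ}`. The tree's weak class carries `L²` data, so all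
   three are typed for mean-zero `θ₀ ∈ L²(T²)` (`‖θ₀‖_{TV} = ‖θ₀‖_{L¹}` for `θ₀ ∈ L¹`): the special
   cases `TV ∩ L² = L²`, `L^p ∩ L²` (no restriction for `p ≥ 2` on the probability space `T²`; for
   `‖θ₀‖_{L^p} = ∞` the typed `ℝ≥0∞` inequality is trivially true) and `H^{-σ} ∩ L² = L²`.
   The extension to measure / distributional data (by density and the linear estimate) is not typed.
2. TIME REGULARITY OF THE FIELD. Printed: `V ∈ C^{α/(1-α)}([0,1], L^∞(T²))` with
   `C^a = C^{⌊a⌋, a-⌊a⌋}` (so for `α ≥ 1/2`, `V` is `⌊α/(1-α)⌋` times differentiable in time as an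
   `L^∞`-valued map). Typed: `‖V(t,x) - V(s,x)‖ ≤ A |t-s|^{min(1, α/(1-α))}` for all `x` and
   `s, t ∈ [0,1]` — equal to the printed class for `α < 1/2` (there `V(t,·)` is continuous, so the
   `L^∞` norm is a supremum) and the Lipschitz-in-time consequence of it for `α ≥ 1/2` (a `C^1` map
   on the compact `[0,1]` is Lipschitz). WEAKER for `α ≥ 1/2`; the higher time differentiability is
   quoted here, not typed.
3. PRINT NIT MADE PRECISE (Definition 1.2). The proof of Cor. 1.3 (§2.5, p. 13) rests on the operator
   identity `T^{κ,W}_{0,1} = e^{κΔ/4} T^{κ/4,Ṽ}_{0,1} T^{κ/4,V}_{0,1} e^{κΔ/4}`, `Ṽ(t,x) = V(1-t,x)`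
   (TeX l. 978), which holds for the time-compressed field WITH the speed factor `4`,
   `W(t,x) = 4V(4t-1,x) 1_{[1/4,1/2]}(t) + 4V(3-4t,x) 1_{[1/2,3/4]}(t)`: substituting `s = 4t - 1`,
   `θ̃(s) = θ((1+s)/4)` solves `∂ₛθ̃ + (λ/4) V·∇θ̃ = (κ/4) Δθ̃` when `W = λ V(4t-1)` on `[1/4,1/2]`,
   so `λ = 4` gives `T^{κ/4,V}` and the printed `λ = 1` gives `T^{κ/4,V/4}`, to which Theorem 1.1
   (stated for `V`) does not apply verbatim. The paper's own time rescalings carry the speed factor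
   (Def. 2.7 (2.2): `τₙ⁻¹ U(τₙ⁻¹(t - tₙ) + n, x)`; Def. 2.11 (2.4): `σₙ⁻¹ Rⁿ v(σₙ⁻¹(t - s_{n+1}), R⁻ⁿx)`),
   so the omitted `4` in Def. 1.2 is a misprint. `HessChildsRowan2025a.forwardBackwardField V` is
   the field WITH the factor `4` — the one the printed proof treats — and `HessChildsRowan2025a_cor13`
   is stated for it. (At `t = 1/2` both indicators are `1`, as printed; a single instant is
   invisible to weak solutions.)
4. `H^{±σ}` NORMALISATION: see *Rendering* (constants absorbed in `C(α)`); the tree's spectral norms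
   are the inhomogeneous `Torus.eSobolevNorm` of the complexified scalar (`fun x => (θ x : ℂ)`), as
   in `EulerFlowsScalarAnomalousDissipation.lean`.
5. Cor. 1.3 is typed together with the clauses of Thm. 1.1 for the SAME `V` ("Let `V` be as in
   Theorem 1.1"), so `HessChildsRowan2025a_thm11` is a projection of `HessChildsRowan2025a_cor13`
   (proved in the companion `UniversalTotalAnomalousDissipatorProofs.lean`).

## Not typed here (with reasons)

* Thm. 2.4 / Cor. 3.x (the two-cell dissipator on the box `B` with boundary data treated as error),
  Thm. 2.6 (the extraction from [ACM19, §8]), Props. 3.1/3.3/4.2/4.3 and the drift–diffusion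
  stability lemmas of App. A: construction-internal (boundary-value problems on `B`).
* (1.6) (total-variation convergence of the law of the SDE (1.5) to the uniform measure) and §2.4
  (maximal spreading of stochastic trajectories, "the complete argument is only suggested"): the
  first is Thm. 1.1 read through the Fokker–Planck correspondence, the second is heuristic.
* Remark 2.1 (the dissipation measure of `V` is purely atomic, `∑ⱼ c^j_{θ₀} δ_{tⱼ}`): "one can
  readily see from the proof", no statement with hypotheses is printed.
* The companion paper's Thm. 1.1 (arXiv:2508.00115: rate `κ^{(1-α)²/12}`, `κ ∈ (0,1)`, field
  `V ∈ L^∞([0,1], C^α)` of its Def. 2.5) is quoted in `AcceleratingDissipationEnhancement.lean`;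
  its Cor. 1.2 is `HessChildsRowan2025_cor12` there.
-/

noncomputable section

namespace Literature.Analysis.FluidPDE

open _root_.MeasureTheory _root_.Set _root_.Filter
open scoped NNReal ENNReal Topology

namespace Torus

variable {d : Type*} [Fintype d]

/-- `θ : ℝ → T^d → ℝ` is (the) `L²`-continuous representative on the time set `S`:
`θ(t) ∈ L²(T^d)` for `t ∈ S` and `‖θ(t) - θ(t₀)‖²_{L²} → 0` as `t → t₀` within `S`
(`θ ∈ C(S; L²(T^d))`, the class of the unique solutions in Armstrong–Vicol, Thm. 1.1, and in
Hess-Childs–Rowan; the phrasing of `ArmstrongVicol2025.IsTimeHolderAlong`, named). Weak solutions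
of the tree (`Torus.IsWeakScalarTransportOn`, `Torus.IsWeakScalarTransportDiagOn`) are determined
for a.e. `t` only; this predicate names the representative whose time slices one may evaluate
(Armstrong–Vicol: "the family of unique solutions `{θ^κ}_{κ>0} ∈ C([0,1];L²(T^d))`"; Evans, §5.9.2,
the space `C([0,T]; X)`). [cite: ArmstrongVicol2025, Thm. 1.1 p. 3 (the class `C([0,1];L²(T^d))`)] -/
def IsL2ContinuousOn (S : Set ℝ) (θ : ℝ → UnitAddTorus d → ℝ) : Prop :=
  (∀ t ∈ S, MemLp (θ t) 2 volume) ∧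
    ∀ t₀ ∈ S, Tendsto (fun t => Torus.scalarL2Sq (θ t - θ t₀)) (𝓝[S] t₀) (𝓝 0)

end Torus

namespace HessChildsRowan2025a

/-- **The carrier class of Theorem 1.1 / Lemma 2.12 / (2.4)**, on the unit torus (module docstring,
*Rendering*): a velocity field `V : ℝ → T² → ℝ²` which is space–time measurable, bounded by `A`,
`α`-Hölder in space with constant `A` at every time (`V ∈ L^∞([0,1], C^α(T²))`), Hölder in time on
`[0,1]` uniformly in `x` with exponent `min(1, α/(1-α))` (printed: `V ∈ C^{α/(1-α)}([0,1], L^∞(T²))`,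
`C^a = C^{⌊a⌋,a-⌊a⌋}`; typed reading = recorded weakening 2 of the module docstring), weakly
divergence free at every time ("divergence-free vector field"), and vanishing for `t ≤ 1/2`
((2.4): "`V(t,x) := 0`, `t ≤ 1/2`"; the typed field is defined for every `t ∈ ℝ`, which changes
nothing for weak solutions on `[0,1)`). [cite: HessChildsRowan2025a, Thm. 1.1 p. 1; Def. 2.11 (2.4) p. 11; Lemma 2.12 p. 12] -/
def IsCarrier (α : ℝ≥0) (V : ℝ → UnitAddTorus (Fin 2) → EuclideanSpace ℝ (Fin 2)) : Prop :=
  AEStronglyMeasurable (FunctionSpaces.Torus.stLift V) volume ∧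
  (∃ A : ℝ≥0,
    (∀ (t : ℝ) (x : UnitAddTorus (Fin 2)), ‖V t x‖ ≤ A) ∧
    (∀ t : ℝ, HolderWith A α (V t)) ∧
    (∀ (x : UnitAddTorus (Fin 2)), ∀ s ∈ Icc (0 : ℝ) 1, ∀ t ∈ Icc (0 : ℝ) 1,
      ‖V t x - V s x‖ ≤ (A : ℝ) * |t - s| ^ min (1 : ℝ) ((α : ℝ) / (1 - (α : ℝ))))) ∧
  (∀ t : ℝ, FunctionSpaces.Torus.IsWeaklyDivFree (V t)) ∧
  (∀ t : ℝ, t ≤ 1 / 2 → V t = 0)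

/-- **Uniform total dissipation in `L¹` of all `L²` data (the estimate (1.2) of Theorem 1.1)** for
a field `V` on the unit torus with the diffusion `κ (½ ∂₀∂₀ + ∂₁∂₁)` (the flat torus
`[0,√2] × [0,1]` of Def. 2.2 in unit-torus coordinates, module docstring *Rendering*): there is
`C > 0` such that for all `κ > 0`, all mean-zero `θ₀ ∈ L²(T²)` and every weak solution `θ` of
`∂ₜθ + V·∇θ = κ (½ ∂₀∂₀ + ∂₁∂₁) θ`, `θ(0) = θ₀` on `T² × [0,1)`
(`Torus.IsWeakScalarTransportDiagOn 1 ![2⁻¹, 1] κ V θ₀ θ`) which is the `L²`-continuous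
representative on `[0,1]` (`Torus.IsL2ContinuousOn (Icc 0 1) θ`; printed: "the unique solution
`θ^κ`"), `‖θ(1)‖_{L¹(T²)} ≤ C κ^{(1-α)²/72} ‖θ₀‖_{L¹(T²)}` (printed for mean-zero `θ₀ ∈ TV(T²)`
with `‖θ₀‖_{TV}` on the right; typed for the data class `L² ⊆ TV`, recorded weakening 1). [cite: HessChildsRowan2025a, Thm. 1.1 (1.2), p. 1] -/
def DissipatesTotally (α : ℝ≥0) (V : ℝ → UnitAddTorus (Fin 2) → EuclideanSpace ℝ (Fin 2)) : Prop :=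
  ∃ C : ℝ, 0 < C ∧ ∀ κ : ℝ, 0 < κ →
    ∀ θ₀ : UnitAddTorus (Fin 2) → ℝ, MemLp θ₀ 2 volume → ∫ x, θ₀ x = 0 →
      ∀ θ : ℝ → UnitAddTorus (Fin 2) → ℝ,
        Torus.IsWeakScalarTransportDiagOn 1 ![2⁻¹, 1] κ V θ₀ θ →
        Torus.IsL2ContinuousOn (Icc 0 1) θ →
          eLpNorm (θ 1) 1 volume ≤
            ENNReal.ofReal (C * κ ^ ((1 - (α : ℝ)) ^ 2 / 72)) * eLpNorm θ₀ 1 volume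

/-- **The forward–backward field `W` of Definition 1.2** (p. 2), built from `V`: the field `V` run
at speed `4` on `[1/4, 1/2]`, then backwards at speed `4` on `[1/2, 3/4]`, and `0` on
`[0,1/4) ∪ (3/4,1]` (heat flow only):
`W(t,x) = 4 V(4t-1, x) 1_{[1/4,1/2]}(t) + 4 V(3-4t, x) 1_{[1/2,3/4]}(t)`.
Printed WITHOUT the two speed factors `4` — a misprint: the proof of Cor. 1.3 (p. 13) uses
`T^{κ,W}_{0,1} = e^{κΔ/4} T^{κ/4,Ṽ}_{0,1} T^{κ/4,V}_{0,1} e^{κΔ/4}`, which is the identity for the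
field with the factors (module docstring, recorded reading 3; cf. the paper's own rescalings
(2.2), (2.4)). Both indicators equal `1` at `t = 1/2`, as printed. [cite: HessChildsRowan2025a, Def. 1.2 p. 2; §2.5 p. 13] -/
def forwardBackwardField (V : ℝ → UnitAddTorus (Fin 2) → EuclideanSpace ℝ (Fin 2)) :
    ℝ → UnitAddTorus (Fin 2) → EuclideanSpace ℝ (Fin 2) := fun t x =>
  (if t ∈ Icc (1 / 4 : ℝ) (1 / 2) then (4 : ℝ) • V (4 * t - 1) x else 0) +
    (if t ∈ Icc (1 / 2 : ℝ) (3 / 4) then (4 : ℝ) • V (3 - 4 * t) x else 0)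

/-- **The estimates (1.3)–(1.4) of Corollary 1.3** for a field `W` on the unit torus with the
diffusion `κ (½ ∂₀∂₀ + ∂₁∂₁)` (module docstring, *Rendering*): there is `C > 0` such that for all
`κ > 0`, all mean-zero `θ₀ ∈ L²(T²)` and every weak solution `θ` of
`∂ₜθ + W·∇θ = κ (½ ∂₀∂₀ + ∂₁∂₁) θ`, `θ(0) = θ₀` on `T² × [0,1)` which is the `L²`-continuous
representative on `[0,1]`:
(1.3) `‖θ(1)‖_{L^p(T²)} ≤ C κ^{(1-α)²/72} ‖θ₀‖_{L^p(T²)}` for every `p ∈ [1,∞]` (an `ℝ≥0∞`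
inequality of `eLpNorm`s: trivially true when `‖θ₀‖_{L^p} = ∞`, i.e. the content is for
`θ₀ ∈ L² ∩ L^p`), and
(1.4) `‖θ(1)‖_{H^σ(T²)} ≤ C κ^{(1-α)²/144} ‖θ₀‖_{H^{-σ}(T²)}` for every `σ ∈ [0, (1-α)²/288]`
(spectral norms `Torus.eSobolevNorm (±σ)` of the complexified slices; printed for all mean-zero
`θ₀ ∈ H^{-σ}`, typed for `θ₀ ∈ L²`, recorded weakening 1; normalisation: recorded reading 4). [cite: HessChildsRowan2025a, Cor. 1.3 (1.3)–(1.4), p. 2; proof §2.5 p. 13] -/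
def DissipatesAllNorms (α : ℝ≥0) (W : ℝ → UnitAddTorus (Fin 2) → EuclideanSpace ℝ (Fin 2)) : Prop :=
  ∃ C : ℝ, 0 < C ∧ ∀ κ : ℝ, 0 < κ →
    ∀ θ₀ : UnitAddTorus (Fin 2) → ℝ, MemLp θ₀ 2 volume → ∫ x, θ₀ x = 0 →
      ∀ θ : ℝ → UnitAddTorus (Fin 2) → ℝ,
        Torus.IsWeakScalarTransportDiagOn 1 ![2⁻¹, 1] κ W θ₀ θ →
        Torus.IsL2ContinuousOn (Icc 0 1) θ →
          (∀ p : ℝ≥0∞, 1 ≤ p →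
            eLpNorm (θ 1) p volume ≤
              ENNReal.ofReal (C * κ ^ ((1 - (α : ℝ)) ^ 2 / 72)) * eLpNorm θ₀ p volume) ∧
          (∀ σ : ℝ, 0 ≤ σ → σ ≤ (1 - (α : ℝ)) ^ 2 / 288 →
            FunctionSpaces.Torus.eSobolevNorm σ (fun x => (θ 1 x : ℂ)) ≤
              ENNReal.ofReal (C * κ ^ ((1 - (α : ℝ)) ^ 2 / 144)) *
                FunctionSpaces.Torus.eSobolevNorm (-σ) (fun x => (θ₀ x : ℂ)))

end HessChildsRowan2025a

/-- **Hess-Childs–Rowan 2025, Theorem 1.1 (a universal total anomalous dissipator)**, as printed on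
the flat torus `T² = [0,√2] × [0,1]` (Def. 2.2) with the isotropic `κΔ`, written on the unit torus
where `κΔ` becomes `κ (½ ∂₀∂₀ + ∂₁∂₁)` (module docstring, *Rendering*): for every `α ∈ (0,1)` there
is a divergence-free field `V` of the class `HessChildsRowan2025a.IsCarrier α` (`L^∞_t C^α_x`,
Hölder in time into `L^∞_x`, `V = 0` for `t ≤ 1/2`) with `HessChildsRowan2025a.DissipatesTotally α V`:
ONE constant `C(α)` such that for ALL `κ > 0` and ALL mean-zero data,
`‖θ^κ(1)‖_{L¹} ≤ C κ^{(1-α)²/72} ‖θ₀‖_{L¹}` — asymptotic total dissipation of every datum at an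
explicit algebraic rate, uniformly in the datum (the strongest all-data statement in print:
§1.3, "it is not clear what a stronger anomalous dissipation result would be", p. 5). Data class
typed `L² ⊆ TV` (recorded weakening 1), time regularity as in recorded weakening 2.
Source form quoted in the module docstring. [cite: HessChildsRowan2025a, Thm. 1.1 (1.2) p. 1; Def. 2.2 p. 7; Def. 2.11 (2.4) p. 11; Lemma 2.12 p. 12] -/
def HessChildsRowan2025a_thm11 : Prop :=
  ∀ α : ℝ≥0, 0 < α → α < 1 →
    ∃ V : ℝ → UnitAddTorus (Fin 2) → EuclideanSpace ℝ (Fin 2),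
      HessChildsRowan2025a.IsCarrier α V ∧ HessChildsRowan2025a.DissipatesTotally α V

/-- **Hess-Childs–Rowan 2025, Corollary 1.3 (total dissipation in every `L^p` and `H^{-σ} → H^σ`
smoothing at time `1`)**, as printed on the flat torus `[0,√2] × [0,1]` written on the unit torus
(module docstring, *Rendering*), together with the clauses of Theorem 1.1 for the SAME field `V`
("Let `V` be as in Theorem 1.1", Def. 1.2): for every `α ∈ (0,1)` there is `V` with
`HessChildsRowan2025a.IsCarrier α V`, `HessChildsRowan2025a.DissipatesTotally α V`, and, for the
forward–backward field `W = HessChildsRowan2025a.forwardBackwardField V` of Definition 1.2 (with the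
speed factor `4` the printed proof uses — recorded reading 3), `HessChildsRowan2025a.DissipatesAllNorms α W`:
ONE `C(α)` with `‖θ^κ(1)‖_{L^p} ≤ C κ^{(1-α)²/72} ‖θ₀‖_{L^p}` for all `p ∈ [1,∞]` and
`‖θ^κ(1)‖_{H^σ} ≤ C κ^{(1-α)²/144} ‖θ₀‖_{H^{-σ}}` for all `σ ∈ [0,(1-α)²/288]`, all `κ > 0`, all
mean-zero `L²` data (recorded weakening 1). `HessChildsRowan2025a_thm11` is its projection. [cite: HessChildsRowan2025a, Cor. 1.3 (1.3)–(1.4) and Def. 1.2, p. 2; proof §2.5 p. 13; Thm. 1.1 p. 1] -/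
def HessChildsRowan2025a_cor13 : Prop :=
  ∀ α : ℝ≥0, 0 < α → α < 1 →
    ∃ V : ℝ → UnitAddTorus (Fin 2) → EuclideanSpace ℝ (Fin 2),
      HessChildsRowan2025a.IsCarrier α V ∧ HessChildsRowan2025a.DissipatesTotally α V ∧
        HessChildsRowan2025a.DissipatesAllNorms α (HessChildsRowan2025a.forwardBackwardField V)

end Literature.Analysis.FluidPDE

end
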